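import Summits.QuantumFields.YangMills.Theorems.BalabanUVNodesN15KingModelBoxForm
import HarnessLib

/-!
# BalabanUVNodes ∕ N15 — THE KING-MODEL RUNG (PART Ν-e): KING's FREE FIELD ON THE BOX WITH FREE BOUNDARY CONDITIONS IS REFLECTION POSITIVE ABOUT
# EVERY MID-PLANE — the image sum and the free-boundary operator are invariant under the box reflection `s_κ ↦ n_κ−1−s_κ`, the operator is
# ferromagnetic across the cut, and the precision criterion applies
# (Track A, DAG node N15 = NE2; FAN-OUT v1.1 §N15 s3 «KING-MODEL RUNG»; ties PART Ϗ (torus RP) to PART Ν (box); count-neutral)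

HONEST FRAMING.  Count-neutral (cell `pub-ymgap`, seat `pub-ymgap-dag-n15-e` g39; `--supports stmt-QuantumFields-27366 --as helper` = K3⁸).
TEMPLATE LITERATURE: C. King, Commun. Math. Phys. **102** (1986) 649–677 [King1986] §4 p.670 (free boundary conditions on `Ω`; images), (2.6) p.652;
Glimm–Jaffe [GlimmJaffe1987] §7.10 Thm. 7.10.3 («the lattice analogs of Theorems 7.10.1 and 7.10.2 hold»); FILS [FILS1978] Thm. 2.1.  PART Ϗ
(`…KingModelTorusHalfSpaces`, Literature `GaussianPrecisionReflectionPositivity`) proved reflection positivity of King's free field on the TORUS from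
the precision criterion (positive-definite `θ`-invariant precision, ferromagnetic across the cut).  THIS FILE proves it for the BOX `Ω` with FREE
boundary conditions (parts Ν-a…Ν-d): (§1) the mid-plane reflection `θ_κ : s_κ ↦ n_κ−1−s_κ` (`boxRefl`, `Fin.rev`), which for `n_κ` even swaps the half
box `{val s_κ < n_κ∕2}` with its complement; on the doubled torus `dblBox∘θ_κ = (σ_κ + n_κe_κ)∘dblBox`, the half-period shift `n_κe_κ` COMMUTES with
every multi-reflection (`−n_κ = n_κ` mod `2n_κ`), so the image sum is `θ_κ`-invariant (★ `kingBoxGreen_boxRefl`, from `lapF_inv_torRefl` +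
`lapF_inv_transl`) and hence so is its inverse, the free-boundary operator (★ `boxOp_boxRefl`, no stencil case analysis); (§2) the free-boundary operator
is a Z-matrix (`boxOp_offdiag_nonpos`) and the only bonds crossing the cut join a site of the slice `n_κ∕2−1` to its own mirror image
(`boxOp_apply_boxRefl_of_ne`), so it is FERROMAGNETIC ACROSS THE CUT (★ `boxOp_cut_nonpos`, via Literature `cut_nonpos_of_nearestNeighbour`); (§3) with
part Ν-d's `boxOp_posDef` the precision criterion gives ★★★ **`freeField_isReflectionPositive_box`** — `N(0,(c(−Δ_free)+m²)⁻¹)` on `ℝ^Ω` IS REFLECTION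
POSITIVE about the mid-plane of every direction with `n_κ` even, ON ALL BOUNDED HALF-BOX OBSERVABLES (the tree's `IsReflectionPositive`), its Gram form
★★★ `kingBoxGreen_reflection_positive` (`0 ≤ Σ a_i a_j G^{Ω}(θz_i, z_j)` on the half box), the real form, reflection invariance, and the same for King's
density-defined law `gaussLaw (boxOp n c m²)` (★★ `boxLaw_isReflectionPositive`).
NOT Bałaban's covariant objects; NOT a node discharge (N15 is booked through n15-a's knit, untouched); NOT chessboard ∕ infrared bounds; nothing
continuum-YM ∕ `ℝ⁴` ∕ OS axioms ∕ Clay.  0 `sorry`.  PRIOR TREE ART: PART Ϗ (torus, same criterion); Literature `TiltedTorusSwapRP` ∕ AllWindowsColdBox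
(other kernels); the criterion is Glimm–Jaffe's ∕ FILS's.

OBJECTS (data).  `boxRefl n κ : KingBox n → KingBox n`, `boxReflPerm n κ : Equiv.Perm (KingBox n)`, `halfShift n κ : Tor (dblPer n)` (`n_κe_κ`).

WHAT THIS FILE PROVES (kernel).  §1 `boxRefl_apply_same∕_ne`, `val_boxRefl_same`, `boxRefl_boxRefl`, ★ `boxRefl_mem_half_iff`, `halfShift_apply_same∕_ne`, ★ `dblBox_boxRefl`,
★ `torReflS_add_halfShift`, `torReflS_comm`, ★ `kingBoxGreen_boxRefl`, ★ `boxOp_boxRefl`.  §2 `boxOp_eq_zero_of_not_adj`, `boxOp_offdiag_nonpos`, `boxSucc_apply_same∕_ne`,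
`boxPred_apply_same∕_ne`, `val_boxSucc_kappa_le`, `val_boxPred_kappa_le`, ★ `boxOp_apply_boxRefl_of_ne`, `boxRefl_ne_self`, ★ `boxOp_cut_nonpos`.  §3 ★★★ **`kingBoxGreen_reflection_positive`**,
★★★ **`freeField_isReflectionPositive_box`**, `freeField_isReflectionPositiveReal_box`, `freeField_isReflectionInvariant_box`, ★★ `boxLaw_isReflectionPositive`.

HONEST SCOPE.  `n_κ` EVEN for the half-box statements (the mid-plane must contain no site); `c ≥ 0`, `m² > 0`; any `d`, any other sides.  Reflections
THROUGH a slice (`n_κ` odd) are not treated.  King's `A = 0` scalar model; N15 untouched; counts unmoved.  Locators: [King1986] §4 p.670 («(2.13) with free boundary conditions», p.670 l.11), (2.6) p.652, (2.13) p.653, (4.4) p.670 (symbol); [GlimmJaffe1987] §7.10 Thm. 7.10.3, §6.2 Thm. 6.2.2; [FILS1978] Thm. 2.1; [Biskup2009] §5.1 Def. 5.2.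
-/

noncomputable section

open scoped BigOperators symmDiff
open Finset Matrix MeasureTheory ProbabilityTheory

namespace Summit.QuantumFields.YangMills.BalabanUVNodes.N15KingModelRung.TorusSpectral

open Literature.MathematicalPhysics.QuantumFieldTheory (IsPosSemidefKernel gaussianFieldOfKernel)
open Literature.MathematicalPhysics.QuantumFieldTheory.Balaban1983to89.B5Prop11Plancherel (Tor unitVec)
open Literature.MathematicalPhysics.QuantumFieldTheory.Balaban1983to89.QGQInverse (Coercive)
open Literature.MathematicalPhysics.QuantumFieldTheory.King1986.Torus
open Literature.Probability.LatticeModels (IsReflectionPositive IsReflectionPositiveReal IsReflectionInvariant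
  reflectedCovariance_family_nonneg_of_precision gaussianField_isReflectionPositive_of_precision
  gaussianField_isReflectionPositiveReal_of_precision gaussianField_isReflectionInvariant_of_precision cut_nonpos_of_nearestNeighbour
  inv_apply_equiv_of_invariant)
open Summit.QuantumFields.YangMills.BalabanUVNodes.N15.TwoGrid (torRefl torRefl_torRefl torRefl_apply_same torRefl_apply_ne)
open Summit.QuantumFields.YangMills.BalabanUVNodes.N15KingModelRung.Curved (lapF_inv_torRefl)
open Summit.QuantumFields.YangMills.BalabanUVNodes.N15KingModelRung.ProperTime (lapF_inv_nonneg lapF_inv_pos isUnit_lapF)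
open Summit.QuantumFields.YangMills.BalabanUVNodes.N15KingModelRung.FreeField (gaussLaw gaussLaw_eq_gaussianFieldOfKernel)

variable {d : ℕ}

/-! ## §1 The mid-plane reflection of the box in direction `κ` and the half box -/

section BoxReflection

variable (n : Fin (d + 1) → ℕ) [hn : ∀ μ, NeZero (n μ)] (κ : Fin (d + 1))

/-- THE MID-PLANE REFLECTION OF THE BOX in direction `κ`: `s_κ ↦ n_κ − 1 − s_κ` (`Fin.rev`), other coordinates fixed — for `n_κ` even the reflection in
the hyperplane between the slices `n_κ∕2 − 1` and `n_κ∕2`. [cite: GlimmJaffe1987, §7.10 Thm. 7.10.3] -/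
def boxRefl (s : KingBox n) : KingBox n := Function.update s κ (Fin.rev (s κ))

omit hn in
/-- `(θs)_κ = rev s_κ`. [folklore] -/
@[simp] theorem boxRefl_apply_same (s : KingBox n) : boxRefl n κ s κ = Fin.rev (s κ) := by simp [boxRefl]

omit hn in
/-- `(θs)_μ = s_μ` for `μ ≠ κ`. [folklore] -/
@[simp] theorem boxRefl_apply_ne (s : KingBox n) {μ : Fin (d + 1)} (h : μ ≠ κ) : boxRefl n κ s μ = s μ := by simp [boxRefl, h]

omit hn in
/-- `val (θs)_κ = n_κ − 1 − s_κ`. [folklore] -/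
theorem val_boxRefl_same (s : KingBox n) : (boxRefl n κ s κ).val = n κ - 1 - (s κ).val := by
  rw [boxRefl_apply_same, Fin.val_rev]; omega

omit hn in
/-- `θ(θs) = s`. [folklore] -/
@[simp] theorem boxRefl_boxRefl (s : KingBox n) : boxRefl n κ (boxRefl n κ s) = s := by
  funext μ; by_cases h : μ = κ
  · subst h; simp
  · simp [h]

/-- `θ` as a permutation of the box. [folklore] -/
def boxReflPerm : Equiv.Perm (KingBox n) := Function.Involutive.toPerm (boxRefl n κ) (boxRefl_boxRefl n κ)

omit hn in
/-- ★ For `n_κ` even, `θ` swaps the half box `{val s_κ < n_κ∕2}` with its complement. [cite: GlimmJaffe1987, §7.10 Thm. 7.10.3] -/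
theorem boxRefl_mem_half_iff (hn2 : Even (n κ)) (s : KingBox n) :
    boxRefl n κ s ∈ {x : KingBox n | (x κ).val < n κ / 2} ↔ s ∉ {x : KingBox n | (x κ).val < n κ / 2} := by
  simp only [Set.mem_setOf_eq, not_lt]
  rw [val_boxRefl_same]
  obtain ⟨h, hh⟩ := hn2
  have := (s κ).isLt
  omega

/-- The HALF-PERIOD TRANSLATION VECTOR `n_κ e_κ` of the doubled torus. [folklore] -/
def halfShift : Tor (dblPer n) := fun μ => (((if μ = κ then n μ else 0 : ℕ)) : ZMod (2 * n μ))

omit hn in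
/-- `(n_κe_κ)_κ = n_κ`. [folklore] -/
theorem halfShift_apply_same : halfShift n κ κ = ((n κ : ℕ) : ZMod (2 * n κ)) := by simp [halfShift]

omit hn in
/-- `(n_κe_κ)_μ = 0` for `μ ≠ κ`. [folklore] -/
theorem halfShift_apply_ne {μ : Fin (d + 1)} (h : μ ≠ κ) : halfShift n κ μ = 0 := by simp [halfShift, h]

omit hn in
/-- On the doubled torus the box reflection is the block-face reflection followed by the half-period translation: `dblBox (θs) = σ_κ(dblBox s) + n_κe_κ`.
[cite: King1986, §4 p.670] -/
theorem dblBox_boxRefl (s : KingBox n) : dblBox n (boxRefl n κ s) = torRefl (dblPer n) κ (dblBox n s) + halfShift n κ := by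
  funext μ
  by_cases h : μ = κ
  · subst h
    rw [Pi.add_apply, torRefl_apply_same, halfShift_apply_same]
    simp only [dblBox, boxRefl_apply_same, Fin.val_rev]
    have hs := (s μ).isLt
    have hc : (((n μ - ((s μ).val + 1) : ℕ)) : ZMod (2 * n μ)) + (s μ).val + 1 = ((n μ : ℕ) : ZMod (2 * n μ)) := by
      norm_cast; congr 1; omega
    linear_combination hc
  · rw [Pi.add_apply, torRefl_apply_ne _ h, halfShift_apply_ne n κ h, add_zero]
    simp [dblBox, boxRefl_apply_ne n κ s h]

omit hn in
/-- The half-period translation `n_κe_κ` COMMUTES with every multi-reflection (`−n_κ = n_κ` in `ℤ∕2n_κ`). [folklore] -/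
theorem torReflS_add_halfShift (S : Finset (Fin (d + 1))) (z : Tor (dblPer n)) :
    torReflS (dblPer n) S (z + halfShift n κ) = torReflS (dblPer n) S z + halfShift n κ := by
  funext μ
  simp only [torReflS, Pi.add_apply]
  by_cases hS : μ ∈ S
  · simp only [hS, if_true]
    by_cases h : μ = κ
    · subst h
      rw [halfShift_apply_same]
      have h2 : (2 : ZMod (2 * n μ)) * ((n μ : ℕ) : ZMod (2 * n μ)) = 0 := by
        have : ((2 * n μ : ℕ) : ZMod (2 * n μ)) = 0 := ZMod.natCast_self _
        rw [← this]; push_cast; ring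
      linear_combination -h2
    · rw [halfShift_apply_ne n κ h]; ring
  · simp only [hS, if_false]

omit hn in
/-- Two multi-reflections commute. [folklore] -/
theorem torReflS_comm (K : Fin (d + 1) → ℕ) (S T : Finset (Fin (d + 1))) (z : Tor K) :
    torReflS K S (torReflS K T z) = torReflS K T (torReflS K S z) := by
  rw [torReflS_torReflS_eq_symmDiff, torReflS_torReflS_eq_symmDiff, symmDiff_comm]

/-- ★ **THE IMAGE SUM IS INVARIANT UNDER THE BOX REFLECTION**: `G^{Ω}(θs, θt) = G^{Ω}(s,t)` (King's torus covariance is invariant under `σ_κ` and under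
translations, and `n_κe_κ` commutes with the images). [cite: King1986, §4 p.670, (2.17) p.653] -/
theorem kingBoxGreen_boxRefl (c m2 : ℝ) (s t : KingBox n) :
    kingBoxGreen n c m2 (boxRefl n κ s) (boxRefl n κ t) = kingBoxGreen n c m2 s t := by
  unfold kingBoxGreen
  refine Finset.sum_congr rfl fun S _ => ?_
  rw [dblBox_boxRefl, dblBox_boxRefl, torReflS_add_halfShift, Transl.lapF_inv_transl,
    torRefl_eq_torReflS_singleton, torRefl_eq_torReflS_singleton, torReflS_comm (dblPer n) S {κ},
    lapF_inv_torReflS]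

/-- ★ **THE FREE-BOUNDARY OPERATOR IS INVARIANT UNDER THE BOX REFLECTION**: `(c(−Δ_free)+m²)(θs, θt) = (c(−Δ_free)+m²)(s,t)` (`c ≥ 0`, `m² > 0`; the inverse
of the `θ`-invariant matrix `G^{Ω}`). [cite: King1986, (2.13) p.653, §4 p.670] -/
theorem boxOp_boxRefl {c m2 : ℝ} (hc : 0 ≤ c) (hm : 0 < m2) (s t : KingBox n) :
    boxOp n c m2 (boxRefl n κ s) (boxRefl n κ t) = boxOp n c m2 s t := by
  have hU : IsUnit (boxOp n c m2).det := (Matrix.isUnit_iff_isUnit_det _).mp (isUnit_boxOp n hc hm)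
  have hG : ∀ x y, (boxOp n c m2)⁻¹ (boxReflPerm n κ x) (boxReflPerm n κ y) = (boxOp n c m2)⁻¹ x y := by
    intro x y
    show (boxOp n c m2)⁻¹ (boxRefl n κ x) (boxRefl n κ y) = (boxOp n c m2)⁻¹ x y
    rw [boxOp_inv_eq_kingBoxGreen n hc hm, boxOp_inv_eq_kingBoxGreen n hc hm, kingBoxGreen_boxRefl]
  have h := inv_apply_equiv_of_invariant (boxReflPerm n κ) hG s t
  rw [Matrix.nonsing_inv_nonsing_inv _ hU] at h
  exact h

end BoxReflection

/-! ## §2 The free-boundary operator is ferromagnetic across the mid-plane cut -/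

section Cut

variable (n : Fin (d + 1) → ℕ) [hn : ∀ μ, NeZero (n μ)] (κ : Fin (d + 1))

omit hn in
/-- An entry of the free-boundary operator VANISHES off the diagonal and off the bonds: if `t ≠ s` and `t` is no in-box neighbour of `s`, `boxOp s t = 0`. [folklore] -/
theorem boxOp_eq_zero_of_not_adj (c m2 : ℝ) {s t : KingBox n} (hst : t ≠ s)
    (hsucc : ∀ (μ : Fin (d + 1)) (h : (s μ).val + 1 < n μ), t ≠ boxSucc n s μ h)
    (hpred : ∀ (μ : Fin (d + 1)) (h : 0 < (s μ).val), t ≠ boxPred n s μ h) : boxOp n c m2 s t = 0 := by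
  unfold boxOp
  simp only [if_neg hst, mul_zero, zero_add]
  have hz : ∀ μ : Fin (d + 1),
      ((if h : (s μ).val + 1 < n μ then ((0 : ℝ) - (if t = boxSucc n s μ h then 1 else 0)) else 0)
        + (if h : 0 < (s μ).val then ((0 : ℝ) - (if t = boxPred n s μ h then 1 else 0)) else 0)) = 0 := by
    intro μ
    have h1 : (if h : (s μ).val + 1 < n μ then ((0 : ℝ) - (if t = boxSucc n s μ h then 1 else 0)) else 0) = 0 := by
      by_cases h : (s μ).val + 1 < n μ
      · rw [dif_pos h, if_neg (hsucc μ h), sub_zero]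
      · rw [dif_neg h]
    have h2 : (if h : 0 < (s μ).val then ((0 : ℝ) - (if t = boxPred n s μ h then 1 else 0)) else 0) = 0 := by
      by_cases h : 0 < (s μ).val
      · rw [dif_pos h, if_neg (hpred μ h), sub_zero]
      · rw [dif_neg h]
    rw [h1, h2, add_zero]
  rw [Finset.sum_congr rfl fun μ _ => hz μ, Finset.sum_const_zero, mul_zero]

omit hn in
/-- Off the diagonal the free-boundary operator is `≤ 0` (`c ≥ 0`): a Z-matrix. [folklore] -/
theorem boxOp_offdiag_nonpos {c : ℝ} (hc : 0 ≤ c) (m2 : ℝ) {s t : KingBox n} (hst : t ≠ s) : boxOp n c m2 s t ≤ 0 := by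
  unfold boxOp
  simp only [if_neg hst, mul_zero, zero_add]
  refine mul_nonpos_of_nonneg_of_nonpos hc (Finset.sum_nonpos fun μ _ => add_nonpos ?_ ?_)
  · by_cases h : (s μ).val + 1 < n μ
    · rw [dif_pos h]; split_ifs <;> norm_num
    · rw [dif_neg h]
  · by_cases h : 0 < (s μ).val
    · rw [dif_pos h]; split_ifs <;> norm_num
    · rw [dif_neg h]

omit hn in
/-- `(s + e_μ)_μ = s_μ + 1`. [folklore] -/
theorem boxSucc_apply_same (s : KingBox n) (μ : Fin (d + 1)) (h : (s μ).val + 1 < n μ) : boxSucc n s μ h μ = ⟨(s μ).val + 1, h⟩ := by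
  unfold boxSucc; rw [Function.update_self]

omit hn in
/-- `(s + e_μ)_ν = s_ν` for `ν ≠ μ`. [folklore] -/
theorem boxSucc_apply_ne (s : KingBox n) (μ : Fin (d + 1)) (h : (s μ).val + 1 < n μ) {ν : Fin (d + 1)} (hν : ν ≠ μ) :
    boxSucc n s μ h ν = s ν := by
  unfold boxSucc; rw [Function.update_of_ne hν]

omit hn in
/-- `(s − e_μ)_μ = s_μ − 1`. [folklore] -/
theorem boxPred_apply_same (s : KingBox n) (μ : Fin (d + 1)) (h : 0 < (s μ).val) :
    boxPred n s μ h μ = ⟨(s μ).val - 1, lt_trans (Nat.sub_lt h Nat.one_pos) (s μ).isLt⟩ := by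
  unfold boxPred; rw [Function.update_self]

omit hn in
/-- `(s − e_μ)_ν = s_ν` for `ν ≠ μ`. [folklore] -/
theorem boxPred_apply_ne (s : KingBox n) (μ : Fin (d + 1)) (h : 0 < (s μ).val) {ν : Fin (d + 1)} (hν : ν ≠ μ) :
    boxPred n s μ h ν = s ν := by
  unfold boxPred; rw [Function.update_of_ne hν]

omit hn in
/-- The `κ`-coordinate of an in-box successor is `≤ s_κ + 1`. [folklore] -/
theorem val_boxSucc_kappa_le (s : KingBox n) (μ : Fin (d + 1)) (h : (s μ).val + 1 < n μ) :
    (boxSucc n s μ h κ).val ≤ (s κ).val + 1 := by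
  by_cases hμ : κ = μ
  · rw [hμ, boxSucc_apply_same]
  · rw [boxSucc_apply_ne n s μ h hμ]; exact Nat.le_succ _

omit hn in
/-- The `κ`-coordinate of an in-box predecessor is `≤ s_κ`. [folklore] -/
theorem val_boxPred_kappa_le (s : KingBox n) (μ : Fin (d + 1)) (h : 0 < (s μ).val) :
    (boxPred n s μ h κ).val ≤ (s κ).val := by
  by_cases hμ : κ = μ
  · rw [hμ, boxPred_apply_same]; exact Nat.sub_le _ _
  · rw [boxPred_apply_ne n s μ h hμ]

omit hn in
/-- ★ In the half box, the ONLY bond crossing the cut joins a site of the last slice `n_κ∕2 − 1` to its own mirror image: for `x ≠ y` in the half box,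
`θy` is neither `x` nor an in-box neighbour of `x`, so `(c(−Δ_free)+m²)(x, θy) = 0`. [cite: GlimmJaffe1987, §7.10 Thm. 7.10.3] -/
theorem boxOp_apply_boxRefl_of_ne (hn2 : Even (n κ)) (c m2 : ℝ) {x y : KingBox n} (hx : (x κ).val < n κ / 2) (hy : (y κ).val < n κ / 2)
    (hxy : x ≠ y) : boxOp n c m2 x (boxRefl n κ y) = 0 := by
  obtain ⟨h, hh⟩ := hn2
  have hθy : (boxRefl n κ y κ).val = n κ - 1 - (y κ).val := val_boxRefl_same n κ y
  have hylt := (y κ).isLt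
  refine boxOp_eq_zero_of_not_adj n c m2 ?_ ?_ ?_
  · intro heq
    have hv : (boxRefl n κ y κ).val = (x κ).val := congrArg (fun s => (s κ).val) heq
    rw [hθy] at hv
    omega
  · intro μ hμ heq
    have hv : (boxRefl n κ y κ).val = (boxSucc n x μ hμ κ).val := congrArg (fun s => (s κ).val) heq
    rw [hθy] at hv
    by_cases hμκ : κ = μ
    · -- the crossing bond: forces `x_κ = y_κ = n_κ∕2 − 1` and then `x = y`
      have hv' : n κ - 1 - (y κ).val = (x κ).val + 1 := by rw [hv, hμκ, boxSucc_apply_same]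
      apply hxy
      funext ν
      by_cases hν : ν = μ
      · rw [hν]
        apply Fin.ext
        have e1 : (x μ).val = (x κ).val := by rw [hμκ]
        have e2 : (y μ).val = (y κ).val := by rw [hμκ]
        omega
      · have h2 := congr_fun heq ν
        rw [boxRefl_apply_ne n κ y (fun h' => hν (h'.trans hμκ)), boxSucc_apply_ne n x μ hμ hν] at h2
        exact h2.symm
    · rw [boxSucc_apply_ne n x μ hμ hμκ] at hv
      omega
  · intro μ hμ heq
    have hv : (boxRefl n κ y κ).val = (boxPred n x μ hμ κ).val := congrArg (fun s => (s κ).val) heq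
    rw [hθy] at hv
    have hle := val_boxPred_kappa_le n κ x μ hμ
    omega

omit hn in
/-- `θx ≠ x` (`n_κ` even: the mid-plane contains no site). [folklore] -/
theorem boxRefl_ne_self (hn2 : Even (n κ)) (x : KingBox n) : boxRefl n κ x ≠ x := by
  intro h
  have h' : (boxRefl n κ x κ).val = (x κ).val := congrArg (fun s => (s κ).val) h
  rw [val_boxRefl_same] at h'
  obtain ⟨k, hk⟩ := hn2
  omega

omit hn in
/-- ★ **`c(−Δ_free)+m²` IS FERROMAGNETIC ACROSS THE MID-PLANE CUT**: `Σ_{x,y} w_x (c(−Δ_free)+m²)(x, θy) w_y ≤ 0` for every `w` supported in the half box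
(`n_κ` even, `c ≥ 0`). [cite: GlimmJaffe1987, §7.10 Thm. 7.10.3] [cite: FILS1978, Thm. 2.1] -/
theorem boxOp_cut_nonpos (hn2 : Even (n κ)) {c : ℝ} (hc : 0 ≤ c) (m2 : ℝ) (w : KingBox n → ℝ)
    (hw : ∀ x, x ∉ {x : KingBox n | (x κ).val < n κ / 2} → w x = 0) :
    ∑ x, ∑ y, w x * boxOp n c m2 x ((boxReflPerm n κ) y) * w y ≤ 0 :=
  cut_nonpos_of_nearestNeighbour (θ := boxReflPerm n κ) (P := {x : KingBox n | (x κ).val < n κ / 2})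
    (fun _ hx _ hy hxy => boxOp_apply_boxRefl_of_ne n κ hn2 c m2 hx hy hxy)
    (fun x _ => boxOp_offdiag_nonpos n hc m2 (boxRefl_ne_self n κ hn2 x)) w hw

end Cut

/-! ## §3 Reflection positivity of King's free field on the box with free boundary conditions -/

section RP

variable (n : Fin (d + 1) → ℕ) [hn : ∀ μ, NeZero (n μ)] (κ : Fin (d + 1))

/-- ★★★ **THE REFLECTED GRAM OF THE FREE-BOUNDARY COVARIANCE IS POSITIVE SEMIDEFINITE ON THE HALF BOX**: for `n_κ` even, `c ≥ 0`, `m² > 0` and every finite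
family `z_i` in the half box `{val s_κ < n_κ∕2}`, `0 ≤ Σ_{i,j} a_i a_j G^{Ω}(θz_i, z_j)` with `G^{Ω} = Σ_S B⁻¹_{T(2n)}(·, σ_S ·)` the image sum.
[cite: King1986, §4 p.670] [cite: GlimmJaffe1987, §7.10 Thm. 7.10.3] -/
theorem kingBoxGreen_reflection_positive (hn2 : Even (n κ)) {c m2 : ℝ} (hc : 0 ≤ c) (hm : 0 < m2) (ι : Type) (F : Finset ι) (a : ι → ℝ)
    (z : ι → KingBox n) (hz : ∀ i ∈ F, (z i κ).val < n κ / 2) :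
    0 ≤ ∑ i ∈ F, ∑ j ∈ F, a i * a j * kingBoxGreen n c m2 (boxRefl n κ (z i)) (z j) := by
  have h := reflectedCovariance_family_nonneg_of_precision (boxOp_posDef n hc hm) (θ := boxReflPerm n κ) (boxRefl_boxRefl n κ)
    (fun x y => boxOp_boxRefl n κ hc hm x y) (P := {x : KingBox n | (x κ).val < n κ / 2}) (boxRefl_mem_half_iff n κ hn2)
    (boxOp_cut_nonpos n κ hn2 hc m2) ι F a z hz
  refine le_of_le_of_eq h (Finset.sum_congr rfl fun i _ => Finset.sum_congr rfl fun j _ => ?_)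
  show a i * a j * (boxOp n c m2)⁻¹ (boxRefl n κ (z i)) (z j) = _
  rw [boxOp_inv_eq_kingBoxGreen n hc hm]

/-- ★★★ **KING's FREE FIELD ON THE BOX `Ω` WITH FREE BOUNDARY CONDITIONS IS REFLECTION POSITIVE** about every mid-plane: for `n_κ` even, `c ≥ 0`, `m² > 0`,
the Gaussian field `N(0, (c(−Δ_free)+m²)⁻¹)` on `ℝ^Ω` is reflection positive with respect to `θ_κ : s_κ ↦ n_κ−1−s_κ` and the half box `{val s_κ < n_κ∕2}`
ON ALL BOUNDED OBSERVABLES measurable in the half-box coordinates (the tree's `IsReflectionPositive`; Glimm–Jaffe Thm. 7.10.3 «lattice analogs»,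
here for FREE rather than periodic boundary conditions — the Neumann bonds are simply absent and the cut argument is unchanged).
[cite: King1986, §4 p.670, (2.13) p.653] [cite: GlimmJaffe1987, §7.10 Thm. 7.10.3, §6.2 Thm. 6.2.2] [cite: FILS1978, Thm. 2.1] -/
theorem freeField_isReflectionPositive_box (hn2 : Even (n κ)) {c m2 : ℝ} (hc : 0 ≤ c) (hm : 0 < m2) :
    IsReflectionPositive (gaussianFieldOfKernel fun s t : KingBox n => (boxOp n c m2)⁻¹ s t) (boxReflPerm n κ) {x : KingBox n | (x κ).val < n κ / 2} :=
  gaussianField_isReflectionPositive_of_precision (boxOp_posDef n hc hm) (boxReflPerm n κ) (boxRefl_boxRefl n κ)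
    (fun x y => boxOp_boxRefl n κ hc hm x y) (boxRefl_mem_half_iff n κ hn2) (boxOp_cut_nonpos n κ hn2 hc m2)

/-- The real form. [cite: GlimmJaffe1987, §7.10 Thm. 7.10.3] [cite: Biskup2009, §5.1 Def. 5.2] -/
theorem freeField_isReflectionPositiveReal_box (hn2 : Even (n κ)) {c m2 : ℝ} (hc : 0 ≤ c) (hm : 0 < m2) :
    IsReflectionPositiveReal (gaussianFieldOfKernel fun s t : KingBox n => (boxOp n c m2)⁻¹ s t) (boxReflPerm n κ)
      {x : KingBox n | (x κ).val < n κ / 2} :=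
  (freeField_isReflectionPositive_box n κ hn2 hc hm).real

/-- The free-boundary field is invariant under `φ ↦ φ∘θ_κ` (any `n_κ`, `c ≥ 0`, `m² > 0`). [cite: GlimmJaffe1987, §6.2 Thm. 6.2.2] -/
theorem freeField_isReflectionInvariant_box {c m2 : ℝ} (hc : 0 ≤ c) (hm : 0 < m2) :
    IsReflectionInvariant (gaussianFieldOfKernel fun s t : KingBox n => (boxOp n c m2)⁻¹ s t) (boxReflPerm n κ) :=
  gaussianField_isReflectionInvariant_of_precision (boxOp_posDef n hc hm) (boxReflPerm n κ) (fun x y => boxOp_boxRefl n κ hc hm x y)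

/-- ★★ **KING's DENSITY-DEFINED FREE FIELD ON THE BOX `ρ_Ω(φ)dφ ∝ exp(−½⟨φ,(c(−Δ_free)+m²)φ⟩)dφ` IS REFLECTION POSITIVE** (`n_κ` even, `c ≥ 0`, `m² > 0`).
[cite: King1986, (2.6) p.652, §4 p.670] [cite: GlimmJaffe1987, §7.10 Thm. 7.10.3] -/
theorem boxLaw_isReflectionPositive (hn2 : Even (n κ)) {c m2 : ℝ} (hc : 0 ≤ c) (hm : 0 < m2) :
    IsReflectionPositive (gaussLaw (boxOp n c m2)) (boxReflPerm n κ) {x : KingBox n | (x κ).val < n κ / 2} := by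
  rw [gaussLaw_eq_gaussianFieldOfKernel hm (boxOp_coercive n hc m2) (boxOp_transpose n hc hm)]
  exact freeField_isReflectionPositive_box n κ hn2 hc hm

end RP

end Summit.QuantumFields.YangMills.BalabanUVNodes.N15KingModelRung.TorusSpectral
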